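import Literature.NumberTheory.EllipticCurves.NeronLocalHeightBadPlaces
import Literature.NumberTheory.EllipticCurves.NeronLocalHeightCompletion
import Literature.NumberTheory.EllipticCurves.NeronLocalHeightVariableChange
import Literature.NumberTheory.EllipticCurves.NeronLocalHeightTateNormalForm
import Literature.NumberTheory.EllipticCurves.TateNormalFormComponents
import Literature.NumberTheory.EllipticCurves.LangHeightArchEstimateProofs
import HarnessLib

/-!
# The `B₂`-inequality for the Néron local height at a split multiplicative place (discharge)

Topic `NumberTheory/EllipticCurves` (family `abc`, G06). Pure proofs, no definitions and no named
facts. Second `Proofs` companion of `NeronLocalHeightBadPlaces.lean` (the first,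
`NeronLocalHeightBadPlacesProofs.lean`, discharges the identity-component fact
`le_neronLocalHeight_twelve_nsmul_of_not_hasSplitMultiplicativeReductionAt`). This file
**discharges** the named fact
`Literature.NumberTheory.EllipticCurves.exists_bernoulli_le_neronLocalHeight_of_hasSplitMultiplicativeReductionAt`
(`NeronLocalHeightBadPlaces.lean`; Silverman, *ATAEC*, Thm. VI.4.2(b) with V.5.3 and VI.1.1(b),(c):
at a place `v` of split multiplicative reduction of `E/ℚ` there is a homomorphism
`r : E(ℚ) → ℝ/ℤ` with `λ_v(Q) ≥ ½𝐁₂(r(Q)) · ord_v(Δ_min) · log p_v` for all `Q ≠ O`), for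
Tate's series `λ_v = neronLocalHeight (padicAbv v)`.

## Proof (assembly)

1. `λ_v` on `E(ℚ)` is the restriction of Tate's series for Mathlib's norm `‖·‖` on the completion
   `ℚ_v` (`neronLocalHeight_baseChange`, ATAEC VI.1.1(c); `‖ι x‖ = |x|_p`,
   `NeronLocalHeightCompletion.lean`).
2. Over `ℚ_v` the equation is changed twice — to the local minimal model `C₁ • W_{ℚ_v}` and then,
   by an `O_v`-integral change of variables `D`, to the Tate normal form
   `J : y² + xy = x³ + αϖⁿ`, `n = ord_v(Δ_min)`, `‖ϖ‖ = p⁻¹`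
   (`exists_variableChange_localMinimalIntegralModel_eq_tateNormalForm`,
   `SplitMultiplicativeNormalForm.lean`) — without changing `λ`
   (`neronLocalHeight_pointEquiv`, ATAEC VI.1.1(b), `NeronLocalHeightVariableChange.lean`).
3. On `J(ℚ_v)` the component homomorphism `c : J(ℚ_v) →+ ℤ/nℤ`
   (`LocalIndex.exists_addMonoidHom_zmod_of_tateNormalForm`, the labelled form of ATAEC
   Cor. IV.9.2(d), `TateNormalFormComponents.lean`) satisfies
   `λ(P) = ½log⁺‖x(P)‖ + ½𝐁₂(c(P)/n) · n v(ϖ) ≥ ½𝐁₂(c(P)/n) · n log p`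
   (`LocalIndex.le_neronLocalHeight_of_tateNormalForm`, ATAEC VI.4.2(b) / Ex. 6.7(b),
   `NeronLocalHeightTateNormalForm.lean`).
4. `r` is `E(ℚ) → E(ℚ_v) ≃ J(ℚ_v) → ℤ/nℤ → ℝ/ℤ` (`ZMod.toAddCircle`).

## References

* J. H. Silverman, *Advanced Topics in the Arithmetic of Elliptic Curves*, GTM 151 (1994),
  Thm. VI.4.2 (PDF p. 430), Ex. 6.7 (PDF p. 434), Thm. VI.1.1 (PDF p. 419), Thm. V.5.3,
  Cor. IV.9.2(d) (PDF p. 340).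
* J. H. Silverman, *Lang's height conjecture and Szpiro's conjecture*, New York J. Math. 16
  (2010), arXiv:0908.3895, proof of Thm. 5.
-/

noncomputable section

open scoped Classical

open IsDedekindDomain

namespace WeierstrassCurve.Affine.Point

/-- Tate's `λ` is unchanged by the transport of points along an equality of Weierstrass
equations (`WeierstrassCurve.Affine.Point.congrEquiv`, the identity on coordinates).
[folklore] -/
theorem neronLocalHeight_congrEquiv {F : Type*} [Field F] (v : AbsoluteValue F ℝ)
    {W₁ W₂ : WeierstrassCurve F} (h : W₁ = W₂) (P : W₁.toAffine.Point) :
    neronLocalHeight v (congrEquiv h P) = neronLocalHeight v P := by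
  subst h
  rfl

end WeierstrassCurve.Affine.Point

namespace Literature.NumberTheory.EllipticCurves

open Rat.HeightOneSpectrum _root_.WeierstrassCurve _root_.WeierstrassCurve.Affine.Point

/-- **Discharge of `exists_bernoulli_le_neronLocalHeight_of_hasSplitMultiplicativeReductionAt`**
(Silverman, *ATAEC*, Thm. VI.4.2(b): `λ(φ(u)) = ½B₂(v(u)/v(q))v(q)` on the Tate curve, with
V.5.3 and VI.1.1(b),(c)), for Tate's series `λ_v = neronLocalHeight (padicAbv v)` on `E(ℚ)`:
the local minimal model at `v` is brought to the Tate normal form `y² + xy = x³ + αϖⁿ`,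
`n = ord_v(Δ_min)` over `O_v` (`SplitMultiplicativeNormalForm.lean`), `λ_v` is transported
there (`neronLocalHeight_baseChange`, `neronLocalHeight_pointEquiv`), and on the normal form
`λ ≥ ½𝐁₂(c/n) · n log p` for the component homomorphism `c`
(`LocalIndex.exists_addMonoidHom_zmod_of_tateNormalForm`,
`LocalIndex.le_neronLocalHeight_of_tateNormalForm`); `r = (c/n mod ℤ) ∘ (E(ℚ) → J(ℚ_v))`.
[cite: Silverman1994, Thm VI.4.2(b)] -/
theorem exists_bernoulli_le_neronLocalHeight_of_hasSplitMultiplicativeReductionAt_holds :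
    exists_bernoulli_le_neronLocalHeight_of_hasSplitMultiplicativeReductionAt := by
  intro W _ v hs
  -- the completion, its integers, its norm
  set Kv := v.adicCompletion ℚ with hKv
  set Ov := v.adicCompletionIntegers ℚ with hOv
  set abv : AbsoluteValue Kv ℝ := NormedField.toAbsoluteValue Kv with habvdef
  have hna : IsNonarchimedean abv := isNonarchimedean_toAbsoluteValue_adicCompletion v
  have habv : ∀ x : Kv, abv x ≤ 1 ↔ ValuationRing.valuation Ov Kv x ≤ 1 := by
    intro x
    rw [toAbsoluteValue_adicCompletion_le_one_iff, valued_le_one_iff_mem_range_adicCompletionIntegers,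
      RingHom.mem_range, ← ValuationRing.mem_integer_iff, Valuation.mem_integer_iff]
  have hvq : ∀ x : ℚ, abv (algebraMap ℚ Kv x) = padicAbv v x :=
    toAbsoluteValue_adicCompletion_algebraMap v
  have h2 : (2 : Kv) ≠ 0 := by
    rw [← map_ofNat (algebraMap ℚ Kv) 2]
    exact (map_ne_zero _).mpr two_ne_zero
  -- a uniformiser of norm `p⁻¹`
  obtain ⟨ϖ, hϖ, -, hϖnorm⟩ := exists_irreducible_norm_eq v
  have hp : 1 < (natGenerator v : ℝ) := by exact_mod_cast (prime_natGenerator v).one_lt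
  have hL : -Real.log (abv (algebraMap Ov Kv ϖ)) = Real.log (natGenerator v) := by
    change -Real.log ‖(ϖ : Kv)‖ = _
    rw [hϖnorm, Real.log_inv, neg_neg]
  -- the Tate normal form `J` of the local minimal model
  obtain ⟨D, α, hn1, hD⟩ :=
    W.exists_variableChange_localMinimalIntegralModel_eq_tateNormalForm v hs hϖ
  set n := W.ordMinimalDiscriminant v with hn
  set I := W.localMinimalIntegralModel v with hI
  set J : WeierstrassCurve Ov := ⟨1, 0, 0, 0, (α : Ov) * ϖ ^ n⟩ with hJ
  haveI : NeZero n := ⟨by omega⟩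
  obtain ⟨c, hc0, hcl, hcl', hcm⟩ := LocalIndex.exists_addMonoidHom_zmod_of_tateNormalForm
    (K := Kv) J hϖ rfl rfl rfl rfl α.isUnit hn1 rfl
  -- the point maps `E(ℚ) → E(ℚ_v) ≃ (C₁ • E)(ℚ_v) ≃ J(ℚ_v)`
  obtain ⟨ι, hιinj, hι⟩ : ∃ ι : W.toAffine.Point →+ (W.baseChange Kv).toAffine.Point,
      Function.Injective ι ∧ ∀ {x y : ℚ} (h : W.toAffine.Nonsingular x y),
        ∃ h', ι (.some x y h) = .some (algebraMap ℚ Kv x) (algebraMap ℚ Kv y) h' :=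
    ⟨WeierstrassCurve.Affine.Point.baseChange (W' := W) ℚ Kv, map_injective (W' := W) _,
      fun _ => ⟨_, rfl⟩⟩
  set M := W.localMinimalModel v with hM
  obtain ⟨C₁, hC₁⟩ : ∃ C₁ : VariableChange Kv, M = C₁ • W.baseChange Kv := ⟨_, rfl⟩
  have hIM : I.baseChange Kv = M := baseChange_integralModel_eq Ov M
  have hIJ : (D.map (algebraMap Ov Kv)) • I.baseChange Kv = J.baseChange Kv := by
    rw [LocalIndex.baseChange_smul_eq I D, hD]
  haveI hMell : M.IsElliptic := W.isElliptic_localMinimalModel v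
  haveI hIell : (I.baseChange Kv).IsElliptic := by rw [hIM]; exact hMell
  set π₁ : (W.baseChange Kv).toAffine.Point →+ (I.baseChange Kv).toAffine.Point :=
    (congrEquiv (hC₁.symm.trans hIM.symm)).toAddMonoidHom.comp
      (VariableChange.pointEquiv (W.baseChange Kv) C₁).toAddMonoidHom with hπ₁
  set π₂ : (I.baseChange Kv).toAffine.Point →+ (J.baseChange Kv).toAffine.Point :=
    (congrEquiv hIJ).toAddMonoidHom.comp
      (VariableChange.pointEquiv (I.baseChange Kv) (D.map (algebraMap Ov Kv))).toAddMonoidHom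
    with hπ₂
  set Φ : W.toAffine.Point →+ (J.baseChange Kv).toAffine.Point := (π₂.comp π₁).comp ι with hΦ
  refine ⟨(ZMod.toAddCircle (N := n)).comp (c.comp Φ), fun Q hQ => ?_⟩
  -- transport of `λ`
  have hιQ : ι Q ≠ 0 := fun h0 => hQ (hιinj (by rw [h0, _root_.map_zero]))
  have hπ₁Q : π₁ (ι Q) ≠ 0 := by
    rw [hπ₁]
    simp only [AddMonoidHom.coe_comp, Function.comp_apply, AddEquiv.coe_toAddMonoidHom, ne_eq,
      EmbeddingLike.map_eq_zero_iff]
    exact hιQ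
  have hlam : neronLocalHeight abv (Φ Q) = neronLocalHeight (padicAbv v) Q := by
    rw [hΦ, hπ₂, hπ₁]
    simp only [AddMonoidHom.coe_comp, Function.comp_apply, AddEquiv.coe_toAddMonoidHom]
    rw [neronLocalHeight_congrEquiv, neronLocalHeight_pointEquiv abv _ h2, neronLocalHeight_congrEquiv,
      neronLocalHeight_pointEquiv abv _ h2 hιQ, neronLocalHeight_baseChange ι hι hvq Q]
    -- the point of `I(ℚ_v)` is nonzero
    have hne := hπ₁Q
    rw [hπ₁] at hne
    simpa only [AddMonoidHom.coe_comp, Function.comp_apply, AddEquiv.coe_toAddMonoidHom] using hne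
  -- the inequality on the Tate normal form
  have key := LocalIndex.le_neronLocalHeight_of_tateNormalForm (K := Kv) J habv hϖ rfl rfl rfl rfl
    α.isUnit hn1 rfl hna hc0 hcl hcl' hcm (Φ Q)
  rw [hlam, hL] at key
  simpa only [AddMonoidHom.coe_comp, Function.comp_apply] using key

end Literature.NumberTheory.EllipticCurves

end
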